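import Summits.Ventures.PackingBounds.Configurations.LeechCard4600
import Summits.Ventures.PackingBounds.Configurations.LeechSectionCount

/-!
# Coordinate sections of the Leech minimal vectors, II: codes at `cos θ ≤ 1/5` in dimensions `14`–`20`

Framing: lottery ticket; floor = certified bounds/negative ranges. Venture `PackingBounds` (cell `pub-packcert`,
seat `pub-packcert-sdp`), the ATTAINED side of the B2c cells `(n, 1/5)`, `14 ≤ n ≤ 20` (no attained-side entry so
far except `(21, 1/5) ≥ 336`, `Config.CodeFifth21`; certified upper bounds by three-point SDP / Levenshtein LP are
in the cell files).

For a set `J₀` of coordinates (all `≥ 3`) let `S(J₀)` be the set of minimal vectors `y` of the Leech lattice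
(`√8`-scaling, `LeechVectors.lean`) with `y₀ = y₁ = y₂ = 2` and `y_j = 0` for `j ∈ J₀`: the shape-`B` vectors on the
octads through `0, 1, 2` avoiding `J₀` with signs `+, +, +` at `0, 1, 2`, so **`|S(J₀)| = 16 · K(J₀)`** with `K(J₀)`
the number of such octads (one kernel `decide` over the `759` octads per row). Deleting the coordinates `0, 1, 2`
(`cut3`) leaves integer vectors of norm `32 - 12 = 20` with pairwise inner products `y·y' - 12 ≤ 16 - 12 = 4`
(`ip_le_of_mem`), i.e. cosines `≤ 1/5`, in the coordinate subspace `{z : z_j = 0, j ∈ {0, 1, 2} ∪ J₀}` of dimension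
`21 - |J₀|`; `SubspaceTransfer.exists_transfer_orthogonal` moves them to `ℝⁿ` (`exists_code_fifth_of_octads`,
generic in `J₀`). In sphere language (SPLAG Ch. 14 Thm 1, `k = 3`): spheres touching four mutually touching spheres
inside a coordinate section of the Leech packing; `J₀ = ∅` is Conway–Sloane's `(21, 336, 1/5)` code (SPLAG Ch. 14
Example 3; `Config.CodeFifth21`). The sets `J₀` below maximise `K` for each `|J₀|` (exhaustive search over the Golay
code, seat file `work/explore/coordsec.py`; `M₂₄` is transitive on triples): `K = 16, 12, 9, 7, 6, 4` for
`|J₀| = 1, 2, 3, 4, 5, 7`, giving **`A(20, arccos 1/5) ≥ 256`, `A(19, ·) ≥ 192`, `A(18, ·) ≥ 144`, `A(17, ·) ≥ 112`,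
`A(16, ·) ≥ 96`, `A(14, ·) ≥ 64`** (the optimal `|J₀| = 6, 8` sections, `(15, 96)` and `(13, 48)`, are omitted: binary codes
do as well or better there). For comparison, binary codes (`x ↦ ((-1)^{x_i}/√n)_i`) give
`A(n, arccos 1/5) ≥ A₂(n, ⌈2n/5⌉)`, e.g. `A₂(14, 6) = 64` (equal to the row here), `A₂(20, 8) = 256` (equal), and less in
dimensions `16`–`19` (`d = 7, 7, 8, 8`); no value in print was found for these cells (presearch: corpus + galaxy; SPLAG
Table 9.2 tabulates `cos⁻¹ 1/3` only). CAVEAT: a Construction-A analogue — the `16` even sign patterns `(±1)⁵/√5` on each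
block of a packing of `5`-subsets pairwise meeting in `≤ 1` point — gives `16 · D(n, 5, 2)` points at `cos ≤ 1/5`, which can
exceed these rows (Schönheim bound `16 · ⌊n/5 ⌊(n−1)/4⌋⌋`: up to `144, 208, 224, 240` for `n = 16, …, 19`; `16 · 21 = 336` from
the `21` lines of `PG(2, 4)` in dimension `21`); it is not formalised here, so these rows are kernel lower bounds, not claimed
best constructions.

## References
* J. H. Conway, N. J. A. Sloane, *Sphere Packings, Lattices and Groups*, 3rd ed., Ch. 4 §11 (the minimal vectors
  (135)), Ch. 10 §2 (octads), Ch. 14 Theorem 1 and Example 3. [`ConwaySloane1999`]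
-/

namespace Summit.Ventures.PackingBounds.Config.Leech.PrefixFifth

open Finset Golay Summit.Ventures.PackingBounds.Config.Leech

/-! ### The sections -/

/-- The section `S(J₀)`: minimal vectors with `y₀ = y₁ = y₂ = 2` vanishing on `J₀`. -/
noncomputable def sec (J0 : Finset (Fin 24)) : Finset (Fin 24 → ℤ) :=
  leechInt.filter fun y => (y 0 = 2 ∧ y 1 = 2 ∧ y 2 = 2) ∧ ∀ j ∈ J0, y j = 0

/-- Members of `S(J₀)`. -/
theorem mem_sec {J0 : Finset (Fin 24)} {y : Fin 24 → ℤ} (hy : y ∈ sec J0) :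
    y ∈ leechInt ∧ (y 0 = 2 ∧ y 1 = 2 ∧ y 2 = 2) ∧ ∀ j ∈ J0, y j = 0 := by
  simpa [sec] using hy

/-! ### Shapes `A` and `C` contribute nothing (`y₀ = 2` is impossible for them) -/

/-- Shape `A`: no vector satisfies the condition. -/
theorem card_A (J0 : Finset (Fin 24)) :
    (idxA.filter fun p => ((avec p.1.1 p.1.2 p.2.1 p.2.2) 0 = 2 ∧ (avec p.1.1 p.1.2 p.2.1 p.2.2) 1 = 2 ∧
      (avec p.1.1 p.1.2 p.2.1 p.2.2) 2 = 2) ∧ ∀ j ∈ J0, (avec p.1.1 p.1.2 p.2.1 p.2.2) j = 0).card = 0 := by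
  rw [Finset.card_eq_zero, Finset.filter_eq_empty_iff]
  rintro p - ⟨⟨h0, -⟩, -⟩
  -- entries of a shape-`A` vector are `0, ±4, ±8`, never `2` (`PrefixThird.avec_apply_ne_two`, not importable yet)
  revert h0
  unfold avec
  rcases sgn_cases p.2.1 with ha | ha <;> rcases sgn_cases p.2.2 with hb | hb <;> rw [ha, hb] <;> split_ifs <;> omega

/-- Shape `C`: no vector satisfies the condition. -/
theorem card_C (J0 : Finset (Fin 24)) :
    ((univ ×ˢ range 4096).filter fun p : Fin 24 × ℕ =>
      ((cvec p.1 p.2) 0 = 2 ∧ (cvec p.1 p.2) 1 = 2 ∧ (cvec p.1 p.2) 2 = 2) ∧ ∀ j ∈ J0, (cvec p.1 p.2) j = 0).card = 0 := by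
  rw [Finset.card_eq_zero, Finset.filter_eq_empty_iff]
  rintro p - ⟨⟨h0, -⟩, -⟩
  -- entries of a shape-`C` vector are odd (`PrefixThird.cvec_apply_ne_two`, not importable yet)
  rcases cvec_apply_cases p.1 p.2 0 with ⟨_, h | h⟩ | ⟨_, h | h⟩ <;> omega

/-! ### Shape `B`: octads through `0, 1, 2` avoiding `J₀`, signs `+, +, +` -/

/-- `y₀ = y₁ = y₂ = 2` on shape `B`: the octad contains `0, 1, 2` and the first three sign bits are `+`. -/
theorem bvec_012_iff (o : Fin 759) (v : ℕ) :
    (bvec o v 0 = 2 ∧ bvec o v 1 = 2 ∧ bvec o v 2 = 2) ↔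
      ((0 : Fin 24) ∈ osupp o ∧ (1 : Fin 24) ∈ osupp o ∧ (2 : Fin 24) ∈ osupp o) ∧
        (v.testBit 0 = false ∧ v.testBit 1 = false ∧ v.testBit 2 = false) := by
  constructor
  · rintro ⟨h0, h1, h2⟩
    have m0 : (0 : Fin 24) ∈ osupp o := (bvec_ne_zero_iff o v 0).mp (by omega)
    have m1 : (1 : Fin 24) ∈ osupp o := (bvec_ne_zero_iff o v 1).mp (by omega)
    have m2 : (2 : Fin 24) ∈ osupp o := (bvec_ne_zero_iff o v 2).mp (by omega)
    have hp : ∀ j : Fin 24, j.val ≤ 2 → j ∈ osupp o := by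
      intro j hj
      rcases Nat.lt_or_ge j.val 1 with h | h
      · rw [show j = 0 from Fin.ext (by simp; omega)]; exact m0
      rcases Nat.lt_or_ge j.val 2 with h' | h'
      · rw [show j = 1 from Fin.ext (by simp; omega)]; exact m1
      · rw [show j = 2 from Fin.ext (by simp; omega)]; exact m2
    rw [bvec_apply_prefix o v (by norm_num) hp 0 (by decide)] at h0
    rw [bvec_apply_prefix o v (by norm_num) hp 1 (by decide)] at h1
    rw [bvec_apply_prefix o v (by norm_num) hp 2 (by decide)] at h2
    refine ⟨⟨m0, m1, m2⟩, ?_, ?_, ?_⟩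
    · revert h0; simp only [Fin.val_zero]; cases v.testBit 0 <;> simp
    · revert h1; simp only [Fin.val_one]; cases v.testBit 1 <;> simp
    · revert h2; simp only [Fin.val_two]; cases v.testBit 2 <;> simp
  · rintro ⟨⟨m0, m1, m2⟩, hb0, hb1, hb2⟩
    have hp : ∀ j : Fin 24, j.val ≤ 2 → j ∈ osupp o := by
      intro j hj
      rcases Nat.lt_or_ge j.val 1 with h | h
      · rw [show j = 0 from Fin.ext (by simp; omega)]; exact m0
      rcases Nat.lt_or_ge j.val 2 with h' | h'
      · rw [show j = 1 from Fin.ext (by simp; omega)]; exact m1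
      · rw [show j = 2 from Fin.ext (by simp; omega)]; exact m2
    rw [bvec_apply_prefix o v (by norm_num) hp 0 (by decide), bvec_apply_prefix o v (by norm_num) hp 1 (by decide),
      bvec_apply_prefix o v (by norm_num) hp 2 (by decide)]
    simp only [Fin.val_zero, Fin.val_one, Fin.val_two, hb0, hb1, hb2, sgn_false, mul_one, and_self]

/-- The condition on shape `B`: the octad contains `0, 1, 2` and avoids `J₀`, first three sign bits `+`. -/
theorem cond_bvec_iff (J0 : Finset (Fin 24)) (o : Fin 759) (v : ℕ) :
    (((bvec o v) 0 = 2 ∧ (bvec o v) 1 = 2 ∧ (bvec o v) 2 = 2) ∧ ∀ j ∈ J0, (bvec o v) j = 0) ↔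
      (((0 : Fin 24) ∈ osupp o ∧ (1 : Fin 24) ∈ osupp o ∧ (2 : Fin 24) ∈ osupp o) ∧ ∀ j ∈ J0, j ∉ osupp o) ∧
        (v.testBit 0 = false ∧ v.testBit 1 = false ∧ v.testBit 2 = false) := by
  rw [bvec_012_iff]
  constructor
  · rintro ⟨⟨h012, hv⟩, hJ⟩
    exact ⟨⟨h012, fun j hj => (bvec_eq_zero_iff o v j).mp (hJ j hj)⟩, hv⟩
  · rintro ⟨⟨h012, hJ⟩, hv⟩
    exact ⟨⟨h012, hv⟩, fun j hj => (bvec_eq_zero_iff o v j).mpr (hJ j hj)⟩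

set_option maxRecDepth 100000 in
/-- `16` sign patterns are `+` at the first three octad positions. -/
theorem card_patterns_000 :
    ((range 128).filter fun v => v.testBit 0 = false ∧ v.testBit 1 = false ∧ v.testBit 2 = false).card = 16 := by
  decide +kernel

/-- `16 · K` shape-`B` vectors satisfy the condition, `K` the number of admissible octads. -/
theorem card_B (J0 : Finset (Fin 24)) {K : ℕ}
    (hK : (univ.filter fun o : Fin 759 =>
      ((0 : Fin 24) ∈ osupp o ∧ (1 : Fin 24) ∈ osupp o ∧ (2 : Fin 24) ∈ osupp o) ∧ ∀ j ∈ J0, j ∉ osupp o).card = K) :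
    ((univ ×ˢ range 128).filter fun p : Fin 759 × ℕ =>
      (((bvec p.1 p.2) 0 = 2 ∧ (bvec p.1 p.2) 1 = 2 ∧ (bvec p.1 p.2) 2 = 2) ∧ ∀ j ∈ J0, (bvec p.1 p.2) j = 0)).card =
      16 * K := by
  rw [Finset.filter_congr (fun p _ => cond_bvec_iff J0 p.1 p.2),
    Finset.filter_product (fun o : Fin 759 =>
        ((0 : Fin 24) ∈ osupp o ∧ (1 : Fin 24) ∈ osupp o ∧ (2 : Fin 24) ∈ osupp o) ∧ ∀ j ∈ J0, j ∉ osupp o)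
      (fun v : ℕ => v.testBit 0 = false ∧ v.testBit 1 = false ∧ v.testBit 2 = false),
    card_product, hK, card_patterns_000, mul_comm]

/-- **`|S(J₀)| = 16 · K(J₀)`.** [cite: ConwaySloane1999, Ch. 4 §11 (135)] -/
theorem card_sec (J0 : Finset (Fin 24)) {K : ℕ}
    (hK : (univ.filter fun o : Fin 759 =>
      ((0 : Fin 24) ∈ osupp o ∧ (1 : Fin 24) ∈ osupp o ∧ (2 : Fin 24) ∈ osupp o) ∧ ∀ j ∈ J0, j ∉ osupp o).card = K) :
    (sec J0).card = 16 * K := by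
  rw [sec, card_filter_leechInt (fun y => (y 0 = 2 ∧ y 1 = 2 ∧ y 2 = 2) ∧ ∀ j ∈ J0, y j = 0) (card_A J0)
    (card_B J0 hK) (card_C J0)]
  omega

/-! ### Deleting the coordinates `0, 1, 2` -/

/-- `y` with the coordinates `0, 1, 2` set to `0` (integer, norm `20` on the sections). -/
def cut3 (y : Fin 24 → ℤ) : Fin 24 → ℤ := fun j => if j.val < 3 then 0 else y j

/-- Inner products after the cut. -/
theorem ip_cut3 (y y' : Fin 24 → ℤ) : ip (cut3 y) (cut3 y') = ip y y' - (y 0 * y' 0 + y 1 * y' 1 + y 2 * y' 2) := by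
  simp [ip, cut3, Fin.sum_univ_succ]
  ring

/-- `cut3` is injective on each section. -/
theorem cut3_injOn (J0 : Finset (Fin 24)) : Set.InjOn cut3 ↑(sec J0) := by
  intro y hy y' hy' h
  obtain ⟨_, ⟨a0, a1, a2⟩, -⟩ := mem_sec (Finset.mem_coe.mp hy)
  obtain ⟨_, ⟨b0, b1, b2⟩, -⟩ := mem_sec (Finset.mem_coe.mp hy')
  funext j
  by_cases hj : j.val < 3
  · have : j = 0 ∨ j = 1 ∨ j = 2 := by
      rcases Nat.lt_or_ge j.val 1 with h | h
      · exact Or.inl (Fin.ext (by simp; omega))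
      rcases Nat.lt_or_ge j.val 2 with h' | h'
      · exact Or.inr (Or.inl (Fin.ext (by simp; omega)))
      · exact Or.inr (Or.inr (Fin.ext (by simp; omega)))
    rcases this with rfl | rfl | rfl <;> omega
  · have := congrFun h j
    simpa [cut3, hj] using this

/-- The cut, normalised section (in `ℝ²⁴`). -/
noncomputable def pre (J0 : Finset (Fin 24)) : Finset (EuclideanSpace ℝ (Fin 24)) :=
  (sec J0).image fun y => toE 20 (cut3 y)

/-- `|pre J₀| = |S(J₀)|`. -/
theorem card_pre (J0 : Finset (Fin 24)) : (pre J0).card = (sec J0).card := by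
  rw [pre, card_image_of_injOn]
  intro y hy y' hy' h
  exact cut3_injOn J0 hy hy' (toE_injective (by norm_num) h)

/-- The cut vectors are unit vectors after scaling by `1/√20`. -/
theorem norm_pre (J0 : Finset (Fin 24)) : ∀ x ∈ pre J0, ‖x‖ = 1 := by
  intro x hx
  obtain ⟨y, hy, rfl⟩ := mem_image.mp hx
  obtain ⟨hL, ⟨h0, h1, h2⟩, -⟩ := mem_sec hy
  refine norm_toE (by norm_num) ?_
  rw [ip_cut3, ip_self_of_mem hL, h0, h1, h2]; norm_num

/-- Distinct cut vectors have inner product `≤ 1/5`. -/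
theorem inner_pre (J0 : Finset (Fin 24)) : ∀ x ∈ pre J0, ∀ x' ∈ pre J0, x ≠ x' → inner ℝ x x' ≤ 1 / 5 := by
  intro x hx x' hx' hne
  obtain ⟨y, hy, rfl⟩ := mem_image.mp hx
  obtain ⟨y', hy', rfl⟩ := mem_image.mp hx'
  obtain ⟨hL, ⟨h0, h1, h2⟩, -⟩ := mem_sec hy
  obtain ⟨hL', ⟨h0', h1', h2'⟩, -⟩ := mem_sec hy'
  have hyy : y ≠ y' := fun h => hne (by rw [h])
  rw [inner_toE (by norm_num), ip_cut3, h0, h1, h2, h0', h1', h2', div_le_iff₀ (by norm_num)]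
  have h16 : (ip y y' : ℝ) ≤ 16 := by exact_mod_cast ip_le_of_mem hL hL' hyy
  push_cast
  linarith

/-! ### Coordinate normals and the transfer to `ℝⁿ` -/

/-- The coordinate vector `e_j` (integer coordinates). -/
def e (j : Fin 24) : Fin 24 → ℤ := fun i => if i = j then 1 else 0

/-- Testing against `e_j` reads off the coordinate. -/
theorem ip_e (j : Fin 24) (y : Fin 24 → ℤ) : ip (e j) y = y j := by
  simp [ip, e]

/-- The vanishing set `{0, 1, 2} ∪ J₀` of the cut vectors. -/
def zset (J0 : Finset (Fin 24)) : Finset (Fin 24) := (univ.filter fun j : Fin 24 => j.val < 3) ∪ J0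

/-- The cut vectors vanish on `zset J₀`. -/
theorem cut3_apply_eq_zero {J0 : Finset (Fin 24)} {y : Fin 24 → ℤ} (hy : y ∈ sec J0) {j : Fin 24}
    (hj : j ∈ zset J0) : cut3 y j = 0 := by
  obtain ⟨_, -, hJ⟩ := mem_sec hy
  rcases Finset.mem_union.mp hj with h | h
  · have h' := (Finset.mem_filter.mp h).2
    simp [cut3, h']
  · by_cases h' : j.val < 3
    · simp [cut3, h']
    · simp [cut3, h', hJ j h]

/-- The coordinate normals indexed by `zset J₀` (via its increasing enumeration), scaled. -/
noncomputable def normals (J0 : Finset (Fin 24)) {k : ℕ} (hk : (zset J0).card = k) :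
    Fin k → EuclideanSpace ℝ (Fin 24) := fun i => toE 20 (e ((zset J0).orderEmbOfFin hk i))

/-- The normals are pairwise orthogonal and nonzero, hence linearly independent. -/
theorem linearIndependent_normals (J0 : Finset (Fin 24)) {k : ℕ} (hk : (zset J0).card = k) :
    LinearIndependent ℝ (normals J0 hk) := by
  apply linearIndependent_of_ne_zero_of_inner_eq_zero
  · intro i h0
    have hi := inner_toE (q := 20) (by norm_num) (e ((zset J0).orderEmbOfFin hk i)) (e ((zset J0).orderEmbOfFin hk i))
    rw [normals] at h0
    rw [h0, inner_zero_left, ip_e] at hi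
    simp [e] at hi
  · intro i j hij
    rw [normals, normals, inner_toE (by norm_num), ip_e]
    have hne : (zset J0).orderEmbOfFin hk i ≠ (zset J0).orderEmbOfFin hk j :=
      fun h => hij (((zset J0).orderEmbOfFin hk).injective h)
    simp [e, hne]

/-- The cut vectors are orthogonal to the normals. -/
theorem orth_pre (J0 : Finset (Fin 24)) {k : ℕ} (hk : (zset J0).card = k) :
    ∀ x ∈ pre J0, ∀ i, inner ℝ (normals J0 hk i) x = 0 := by
  intro x hx i
  obtain ⟨y, hy, rfl⟩ := mem_image.mp hx
  rw [normals, inner_toE (by norm_num), ip_e, cut3_apply_eq_zero hy ((zset J0).orderEmbOfFin_mem hk i)]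
  simp

/-- **Generic row.** If `K` octads contain `0, 1, 2` and avoid `J₀`, and `n + |{0,1,2} ∪ J₀| = 24`, then there are
`16 · K` unit vectors in `ℝⁿ` with pairwise inner products `≤ 1/5`. [cite: ConwaySloane1999, Ch. 4 §11 (135)] -/
theorem exists_code_fifth_of_octads (J0 : Finset (Fin 24)) {K k n : ℕ}
    (hK : (univ.filter fun o : Fin 759 =>
      ((0 : Fin 24) ∈ osupp o ∧ (1 : Fin 24) ∈ osupp o ∧ (2 : Fin 24) ∈ osupp o) ∧ ∀ j ∈ J0, j ∉ osupp o).card = K)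
    (hk : (zset J0).card = k) (hn : n + k = 24) :
    ∃ C : Finset (EuclideanSpace ℝ (Fin n)),
      C.card = 16 * K ∧ (∀ x ∈ C, ‖x‖ = 1) ∧ (∀ x ∈ C, ∀ y ∈ C, x ≠ y → inner ℝ x y ≤ 1 / 5) := by
  obtain ⟨C', hc, hn', hi, _⟩ := exists_transfer_orthogonal (m := 24) (n := n) (k := k) (by omega) _
    (linearIndependent_normals J0 hk) (pre J0) (orth_pre J0 hk)
  refine ⟨C', by rw [hc, card_pre, card_sec J0 hK], fun x' hx' => ?_, fun x' hx' y' hy' hne => ?_⟩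
  · obtain ⟨x, hx, he⟩ := hn' x' hx'
    rw [he]; exact norm_pre J0 x hx
  · obtain ⟨x, hx, y, hy, hxy, he⟩ := hi x' hx' y' hy' hne
    rw [he]; exact inner_pre J0 x hx y hy hxy

/-! ### The rows `n = 20, …, 16` and `14` (optimal `J₀` for each size; one kernel octad count each) -/

set_option maxRecDepth 100000 in
set_option maxHeartbeats 1000000 in
/-- **`A(20, arccos 1/5) ≥ 256`**: `J₀ = {3}`, `K = 21 - 5 = 16`. [cite: ConwaySloane1999, Ch. 4 §11 (135)] -/
theorem exists_code_dim20_fifth_256 : ∃ C : Finset (EuclideanSpace ℝ (Fin 20)),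
    C.card = 256 ∧ (∀ x ∈ C, ‖x‖ = 1) ∧ (∀ x ∈ C, ∀ y ∈ C, x ≠ y → inner ℝ x y ≤ 1 / 5) :=
  exists_code_fifth_of_octads {3} (K := 16) (by decide +kernel) (k := 4) (by decide +kernel) rfl

set_option maxRecDepth 100000 in
set_option maxHeartbeats 1000000 in
/-- **`A(19, arccos 1/5) ≥ 192`**: `J₀ = {3, 4}`, `K = 21 - 10 + 1 = 12`. [cite: ConwaySloane1999, Ch. 4 §11 (135)] -/
theorem exists_code_dim19_fifth_192 : ∃ C : Finset (EuclideanSpace ℝ (Fin 19)),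
    C.card = 192 ∧ (∀ x ∈ C, ‖x‖ = 1) ∧ (∀ x ∈ C, ∀ y ∈ C, x ≠ y → inner ℝ x y ≤ 1 / 5) :=
  exists_code_fifth_of_octads {3, 4} (K := 12) (by decide +kernel) (k := 5) (by decide +kernel) rfl

set_option maxRecDepth 100000 in
set_option maxHeartbeats 1000000 in
/-- **`A(18, arccos 1/5) ≥ 144`**: `J₀ = {3, 4, 5}`, `K = 9`. [cite: ConwaySloane1999, Ch. 4 §11 (135)] -/
theorem exists_code_dim18_fifth_144 : ∃ C : Finset (EuclideanSpace ℝ (Fin 18)),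
    C.card = 144 ∧ (∀ x ∈ C, ‖x‖ = 1) ∧ (∀ x ∈ C, ∀ y ∈ C, x ≠ y → inner ℝ x y ≤ 1 / 5) :=
  exists_code_fifth_of_octads {3, 4, 5} (K := 9) (by decide +kernel) (k := 6) (by decide +kernel) rfl

set_option maxRecDepth 100000 in
set_option maxHeartbeats 1000000 in
/-- **`A(17, arccos 1/5) ≥ 112`**: `J₀ = {3, 4, 5, 9}`, `K = 7`. [cite: ConwaySloane1999, Ch. 4 §11 (135)] -/
theorem exists_code_dim17_fifth_112 : ∃ C : Finset (EuclideanSpace ℝ (Fin 17)),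
    C.card = 112 ∧ (∀ x ∈ C, ‖x‖ = 1) ∧ (∀ x ∈ C, ∀ y ∈ C, x ≠ y → inner ℝ x y ≤ 1 / 5) :=
  exists_code_fifth_of_octads {3, 4, 5, 9} (K := 7) (by decide +kernel) (k := 7) (by decide +kernel) rfl

set_option maxRecDepth 100000 in
set_option maxHeartbeats 1000000 in
/-- **`A(16, arccos 1/5) ≥ 96`**: `J₀ = {3, 4, 5, 9, 12}`, `K = 6`. [cite: ConwaySloane1999, Ch. 4 §11 (135)] -/
theorem exists_code_dim16_fifth_96 : ∃ C : Finset (EuclideanSpace ℝ (Fin 16)),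
    C.card = 96 ∧ (∀ x ∈ C, ‖x‖ = 1) ∧ (∀ x ∈ C, ∀ y ∈ C, x ≠ y → inner ℝ x y ≤ 1 / 5) :=
  exists_code_fifth_of_octads {3, 4, 5, 9, 12} (K := 6) (by decide +kernel) (k := 8) (by decide +kernel) rfl

set_option maxRecDepth 100000 in
set_option maxHeartbeats 1000000 in
/-- **`A(14, arccos 1/5) ≥ 64`**: `J₀ = {3, 4, 5, 6, 7, 9, 19}`, `K = 4`. [cite: ConwaySloane1999, Ch. 4 §11 (135)] -/
theorem exists_code_dim14_fifth_64 : ∃ C : Finset (EuclideanSpace ℝ (Fin 14)),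
    C.card = 64 ∧ (∀ x ∈ C, ‖x‖ = 1) ∧ (∀ x ∈ C, ∀ y ∈ C, x ≠ y → inner ℝ x y ≤ 1 / 5) :=
  exists_code_fifth_of_octads {3, 4, 5, 6, 7, 9, 19} (K := 4) (by decide +kernel) (k := 10) (by decide +kernel) rfl

end Summit.Ventures.PackingBounds.Config.Leech.PrefixFifth
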